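import Summits.FinalStateConjecture.FinalStateConjecture.Theses.PhaseMixingCapture
import Literature.Geometry.Lorentzian.LateTimeOmegaLimitSet

/-!
# Sketch (crux-ideate, crux `stmt-FinalStateConjecture-9953` = `CaptureSuffices`, round 1,
# ideator 1, gen 2): first lemmas of the two idea cards

* Card `capture-rigidifies-omega-limits` — §1 the abstract lever (PROVED): an ω-limit point inside
  an open "consumable" set forces entry at a finite time, so CAPTURE APPLIED TO THE ORIGINAL FLOW
  (not to the limit object) settles the flow; in a Hausdorff space the ω-limit set then collapses
  to one point. §2 the GR-typed entry lemma (PROVED) over `Spacetime.lateTimeOmegaLimitSet`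
  (`LateTimeOmegaLimitSet.lean`) with `Cᵏ` sup-norm convergence on a slab and a WINDOW-CAPTURE
  hypothesis (the consumable corollary of `BulkKerrCapture` that the line manufactures through the
  quiet-past cone adapter): Kerr components in the late-time ω-limit set ⇒ `ConvergesToKerr`.
* Card `interpolation-defangs-sharp-form` — §3 the interpolation upgrade, stated as a `Prop` over
  `Spacetime.deviationCk` (`KerrConvergence.lean`): `C⁰` decay of the deviation plus a UNIFORM
  `C^{2j}` bound (no decay) in the same late chart give `Cʲ` decay (Landau–Kolmogorov on corner
  cubes of the late region). Not proved here (no Gagliardo–Nirenberg in Mathlib); it is the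
  card's first stub.
-/

-- single-conjunct summit: the problem namespace repeats the summit name
set_option linter.dupNamespace false

noncomputable section

open scoped Topology ENNReal Manifold
open Set Filter Literature.Geometry.Lorentzian

namespace Summit.FinalStateConjecture.FinalStateConjecture.Cruxes.CaptureSuffices.Ideator1g2

/-! ## §1 The abstract lever: capture applied to the original flow rigidifies ω-limit points -/

section Abstract

variable {X : Type*} [TopologicalSpace X]

/-- **Entry.** If the late-time curve `u` has a cluster point `y` at `+∞` lying in an OPEN set
`U` (the consumable neighbourhood of the sub-extremal Kerr family), then `u` visits `U` at
arbitrarily late times. -/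
theorem frequently_mem_of_mapClusterPt {u : ℝ → X} {y : X} {U : Set X} (hU : IsOpen U)
    (hy : y ∈ U) (h : MapClusterPt y atTop u) : ∃ᶠ t in atTop, u t ∈ U :=
  h.frequently (hU.mem_nhds hy)

/-- **Capture rigidifies ω-limit points.** `capture` is the (consumable form of the) capture
hypothesis: whenever the flow is in `U` at some time, it converges to SOME member of the Kerr
family `K`. If ONE cluster point of the flow lies in `U`, the flow converges to a member of `K` —
no identification of the cluster point (no Liouville / no-hair theorem near `K`) is used. -/
theorem tendsto_of_mapClusterPt_mem {u : ℝ → X} {K U : Set X} (hU : IsOpen U)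
    (capture : ∀ t₀ : ℝ, u t₀ ∈ U → ∃ z ∈ K, Tendsto u atTop (𝓝 z))
    {y : X} (hy : y ∈ U) (h : MapClusterPt y atTop u) : ∃ z ∈ K, Tendsto u atTop (𝓝 z) := by
  obtain ⟨t₀, ht₀⟩ := (frequently_mem_of_mapClusterPt hU hy h).exists
  exact capture t₀ ht₀

/-- In a Hausdorff space the whole cluster set then collapses to that one member of `K`
(the ω-limit set is a singleton: "the drift along the family is killed by openness"). -/
theorem clusterPt_unique_of_mapClusterPt_mem [T2Space X] {u : ℝ → X} {K U : Set X}
    (hU : IsOpen U) (capture : ∀ t₀ : ℝ, u t₀ ∈ U → ∃ z ∈ K, Tendsto u atTop (𝓝 z))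
    {y : X} (hy : y ∈ U) (h : MapClusterPt y atTop u) :
    ∃ z ∈ K, Tendsto u atTop (𝓝 z) ∧ ∀ y' : X, MapClusterPt y' atTop u → y' = z := by
  obtain ⟨z, hzK, hz⟩ := tendsto_of_mapClusterPt_mem hU capture hy h
  refine ⟨z, hzK, hz, fun y' hy' ↦ ?_⟩
  have h1 : ClusterPt y' (map u atTop) := hy'.clusterPt
  have h2 : map u atTop ≤ 𝓝 z := hz
  -- `𝓝 y' ⊓ 𝓝 z` is nontrivial, so `y' = z` by the Hausdorff property
  exact t2_iff_nhds.mp ‹T2Space X› (ClusterPt.mono h1 h2).neBot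

end Abstract

/-! ## §2 The GR-typed entry lemma over `Spacetime.lateTimeOmegaLimitSet` -/

section Entry

/-- `Cᵏ` sup-norm convergence on the set `S ⊆ E4` of a sequence of component maps to a limit
component map: the convergence notion `lim` fed to `Spacetime.lateTimeOmegaLimitSet`
(`LateTimeOmegaLimitSet.lean` leaves `lim` a parameter). -/
def CkSupConverges (k : ℕ) (S : Set E4) (s : ℕ → E4 → E4 →L[ℝ] E4 →L[ℝ] ℝ)
    (l : E4 → E4 →L[ℝ] E4 →L[ℝ] ℝ) : Prop :=
  Tendsto (fun n ↦ supCkENorm S k (s n - l)) atTop (𝓝 0)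

variable (𝓢 : Spacetime.{0} 4)

/-- **Window capture at `(M, a)`** (the CONSUMABLE corollary of `BulkKerrCapture` which the line
must manufacture through the quiet-past cone adapter; here a hypothesis): if at some chart time
`T ≥ 0` the translated chart metric `g_T = (Ψ^* g)(· + T∂₀)` is within `ε` of the Kerr
components `g_{M,a}` in `Cᵏ` sup norm on the slab `S_L = {τ₀ < t* < τ₀ + L}`, then the region `𝒟`
converges in `C²` to SOME sub-extremal Kerr. -/
def WindowCaptureAt (𝒟 : Set 𝓢.carrier) (M a : ℝ) (k : ℕ) (ε : ℝ≥0∞)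
    (Ψ : Kerr.exterior M a → 𝓢.carrier) (τ₀ L : ℝ) : Prop :=
  ∀ T : ℝ, 0 ≤ T →
    supCkENorm (Subtype.val '' (Kerr.background M a).timeSlabIoo τ₀ L) k
        (𝓢.translatedChartMetric (Kerr.background M a) Ψ T - Kerr.bilin M a) ≤ ε →
      ∃ M' a' : ℝ, Kerr.IsSubextremal M' a' ∧ 𝓢.ConvergesToKerr 𝒟 M' a' 2

/-- **Entry lemma (card `capture-rigidifies-omega-limits`).** If the Kerr components `g_{M,a}`
belong to the late-time ω-limit set of `𝓢` seen through the chart `Ψ` (for `Cᵏ` sup-norm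
convergence on the slab `S_L`), then window capture at `(M, a)` with ANY positive tolerance `ε`
settles `𝒟` to some sub-extremal Kerr in `C²`: the limit point need not be identified beyond
"within `ε` of `g_{M,a}` once", and nothing is assumed about the other ω-limit points. -/
theorem convergesToKerr_of_kerr_mem_lateTimeOmegaLimitSet {𝒟 : Set 𝓢.carrier} {M a : ℝ}
    {k : ℕ} {ε : ℝ≥0∞} {Ψ : Kerr.exterior M a → 𝓢.carrier} {τ₀ L : ℝ} (hε : 0 < ε)
    (hcap : WindowCaptureAt 𝓢 𝒟 M a k ε Ψ τ₀ L)
    (hΩ : Kerr.bilin M a ∈ 𝓢.lateTimeOmegaLimitSet (Kerr.background M a)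
      (fun S s l ↦ CkSupConverges k S s l) Ψ τ₀ L) :
    ∃ M' a' : ℝ, Kerr.IsSubextremal M' a' ∧ 𝓢.ConvergesToKerr 𝒟 M' a' 2 := by
  obtain ⟨T, hT, hconv⟩ := (𝓢.mem_lateTimeOmegaLimitSet_iff (Kerr.background M a)).1 hΩ
  have h1 : ∀ᶠ n in atTop, supCkENorm (Subtype.val '' (Kerr.background M a).timeSlabIoo τ₀ L) k
      (𝓢.translatedChartMetric (Kerr.background M a) Ψ (T n) - Kerr.bilin M a) ≤ ε :=
    (hconv.eventually (Iio_mem_nhds hε)).mono fun n hn ↦ le_of_lt hn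
  have h2 : ∀ᶠ n in atTop, (0 : ℝ) ≤ T n := hT.eventually (eventually_ge_atTop 0)
  obtain ⟨n, hn1, hn2⟩ := (h1.and h2).exists
  exact hcap (T n) hn2 hn1

end Entry

/-! ## §3 Card `interpolation-defangs-sharp-form`: the interpolation upgrade -/

section Interpolation

/-- **Interpolation upgrade (first stub of card `interpolation-defangs-sharp-form`).** For a late
chart `Ψ` of the Kerr exterior whose deviation `h = Ψ^* g − g_{M,a}` is `C^{2j}` on the late
region: `C⁰` decay of `h` on the slabs `{t* = τ}` (what the ADVERSARIAL witness `k = 0` of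
`BulkKerrCapture`/`NearExtremalKappaCapture` hands over, `captureSuffices_iff_sharp`) together with
a UNIFORM-in-`τ` bound on the `C^{2j}` deviation (bounded late geometry in that chart — NO decay
asked at order `2j`) imply `Cʲ` decay; with `j = 2` this is the `C²` convergence the summit's
`FinalStateDecomposition … 2` demands. Mechanism: Landau–Kolmogorov / Gagliardo–Nirenberg
`‖Dʲh‖_∞ ≲ ‖h‖_∞^{1/2} ‖D^{2j}h‖_∞^{1/2} + ‖h‖_∞` on unit corner cubes of the late region
`{t* ≥ τ} × {r > r₊}` (the complement of a solid ellipsoid contains at every point a unit cube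
with that point as a corner; forward-in-time cubes avoid the initial slab). -/
def InterpolationUpgrade : Prop :=
  ∀ (𝓢 : Spacetime.{0} 4) (M a : ℝ), 0 < M → Kerr.IsSubextremal M a →
    ∀ (𝒟 : Set 𝓢.carrier) (τ₀ : ℝ) (Ψ : Kerr.exterior M a → 𝓢.carrier) (j : ℕ) (𝔅 : ℝ≥0∞),
      𝔅 < ⊤ → 𝓢.IsLateChart (Kerr.background M a) 𝒟 τ₀ Ψ →
      ContDiffOn ℝ (2 * j : ℕ) (𝓢.deviationExtend (Kerr.background M a) Ψ)
        (Subtype.val '' (Kerr.background M a).lateRegion τ₀) →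
      Tendsto (fun τ ↦ 𝓢.deviationCk (Kerr.background M a) Ψ 0 τ) atTop (𝓝 0) →
      (∀ τ : ℝ, τ₀ ≤ τ → 𝓢.deviationCk (Kerr.background M a) Ψ (2 * j) τ ≤ 𝔅) →
      Tendsto (fun τ ↦ 𝓢.deviationCk (Kerr.background M a) Ψ j τ) atTop (𝓝 0)

/-- Sanity: the upgrade with `j = 2` turns the adversarial `k = 0` witness plus bounded `C⁴`
late geometry (same chart) into the `k = 2` convergence of `ConvergesToKerr … 2`
(`Spacetime.ConvergesTo` is `∃ τ₀ Ψ, IsLateEmbedding ∧ Tendsto deviationCk k`). -/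
theorem convergesToKerr_two_of_zero (h : InterpolationUpgrade) (𝓢 : Spacetime.{0} 4) {M a : ℝ}
    (hM : 0 < M) (hsub : Kerr.IsSubextremal M a) {𝒟 : Set 𝓢.carrier} {τ₀ : ℝ}
    {Ψ : Kerr.exterior M a → 𝓢.carrier} {𝔅 : ℝ≥0∞} (h𝔅 : 𝔅 < ⊤)
    (hΨ : 𝓢.IsLateEmbedding (Kerr.background M a) 𝒟 τ₀ Ψ)
    (hsmooth : ContDiffOn ℝ (2 * 2 : ℕ) (𝓢.deviationExtend (Kerr.background M a) Ψ)
      (Subtype.val '' (Kerr.background M a).lateRegion τ₀))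
    (h0 : Tendsto (fun τ ↦ 𝓢.deviationCk (Kerr.background M a) Ψ 0 τ) atTop (𝓝 0))
    (h4 : ∀ τ : ℝ, τ₀ ≤ τ → 𝓢.deviationCk (Kerr.background M a) Ψ (2 * 2) τ ≤ 𝔅) :
    𝓢.ConvergesToKerr 𝒟 M a 2 :=
  ⟨τ₀, Ψ, hΨ, h 𝓢 M a hM hsub 𝒟 τ₀ Ψ 2 𝔅 h𝔅 hΨ.toIsLateChart hsmooth h0 h4⟩

end Interpolation

end Summit.FinalStateConjecture.FinalStateConjecture.Cruxes.CaptureSuffices.Ideator1g2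

end
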